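import Summits.Ventures.HSemireg.Pad4FirstOrderModelEndTerms

/-!
# Venture HSemireg — THEOREM L^ζ step S4: THE END, and `TheoremLZetaMain` ∕ `TheoremLZeta` PROVED in the first-order model
# (companion of `Pad4FirstOrderModel.lean`, row 716; TIER-2 final step)

HONEST FRAMING. PROVED statements about the first-order MODEL of the PAD-4 anchor (seat s4-prove-1 g24, TRACK S4-PUSH lane
(ii), 2026-08-27): `theoremLZetaMain_holds : TheoremLZetaMain` and `theoremLZeta_holds : TheoremLZeta` — the two
`@[conjecture]`-tagged sentences of row 716 (p505821) are THEOREMS of the model (kernel-checked, axioms standard). WHAT THIS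
IS: the cell's pencil THEOREM L^ζ (PAD4-THEOREM-L v1.2 §1–§3, §5; referee ×2) carried out inside the finite-dimensional
coordinate model `Pad4FirstOrderModel.lean` — no two-level ⊕-block line-bundle design of the standard-null-letter class with
minimal presentation and a `≥ 2`-charged constituent satisfies the model's (E1) = `H2`; with (H1) (`μ ≠ 0` forces a fully
charged constituent) the corollary form follows. WHAT THIS IS NOT: a statement about sheaves, Atiyah classes or the
semiregularity map (the model-to-sheaf bridge, Buchweitz–Flenner 2003, is NOT in the tree), nor about other letters, `≥ 3`
levels, higher rank, other pads; NOTHING HERE SAYS THAT HC ∕ HC_CM ∕ HC_AV ∕ W₆ HOLDS OR FAILS; no object is certified.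
THE END (`end_coeff_eq_zero`): for a top flag `X = a ℓ^{(σ)} + h ℓ_ζ^{(f)}` (S2c), a third axis `τ ∉ {σ, f}`, scalars
`μ_j` and ring elements `g_C ∈ R_{c−h}` satisfying the server identities (R1) `Σ_j μ_j φ_{S j} + Σ_C g_C ⋆ φ_{S C} = 0 ∈ R_{s−h}`
and the τ-flag identities (R2) `Σ_j μ_j φ_{X' j} = 0 ∈ R_{a'}`, and a copy `Q₀^{j₀}` whose `E₊`-side system is solvable at
`κ₁ = E_{τf}`: `μ_{j₀} = 0`. Mechanism: the FIXED COMBINATION `Σ_{copies s} μ_s · Row(j₀, s) + Σ_C Σ_{o'} g_C(o') · Row(j₀, C, o')`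
of the kept upper rows of `j₀`, read on the block `(f:1, τ:1)` at `[f ↦ ē_A, τ ↦ y]`: participant by participant (S4a) an
f-server contributes `Σ_ι η'_S(ι, y) · (R1 at ι) = 0`, a τ-flag `ξ̄_{ζ'}(y) Σ_ι η'_{X'}(ι) · (R2 at ι) = 0`, everything else
nothing; while the system gives `μ_{j₀} · ob_{κ₁}(Q₀)(ē_A, y)`, and `ob(ē_A, ē_B) − ζ̄_τ ob(ē_A, ē_A) = ± h ≠ 0` (row 781). No
change of splitting and no normalisation are needed (TIER-2 sizing memo §3c(a) simplified further). ASSEMBLY: top flag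
(S2c) → column reading at `κ₀ = E_{fσ}` (S3: (D), (R1), (R2) with `μ_j = u_j(x)`, `g_C = v_C(x, ·)`) → THE END for every
copy `j₀` and every `x ∈ R_a` ⇒ all `u_j(x) = 0` ⇒ (D)'s left side is `0 = ± a`, `a ≥ 1`: contradiction. So `H2` uses
exactly: the lower columns at the directions `E_{gg'}` (ray rules, column reading) and the upper systems at `E_{gg'}` (upper
ray rule, THE END). No fact, no definition, no instance, no notation. REUSE: rows 716, 731, 739, 781, S2a–S2c, S3a, S3, S4a.
WHAT `TheoremLZeta` ASSERTS, IN MODEL TERMS (one sentence): for every `Design` of row 716 — two finite lists of constituents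
`t·h + Σ_f c_f ℓ_{ζ_f}` on the four factors, ONE null letter of phase `ζ_f ∈ μ₄` and charge `c_f ∈ ℕ` per factor — with
`#N = #P + 4` (`InClassY`) and every section function `φ` without isomorphism entries (`Minimal`), it is NOT the case that the
μ-word is non-zero (`H1`) and that for every `κ ∈ M₄(ℂ)` all the finite ℂ-linear systems of (E1) — every column
`lowerLHS φ η i · = δ·ob_κ(N_i)` and, for every row object `P_j`, `upperLHS φ η' j · = δ·ob_κ(P_j)` on the kept rows
(`UpperRowPure`) — are solvable (`H2`); the proof consumes of row 716 exactly the definitions `rel ∕ idx ∕ monIdx ∕ mulCoef ∕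
coef ∕ coefProd ∕ xiBar ∕ wCoef ∕ kap ∕ qPair ∕ ob ∕ lowerLHS ∕ upperLHS ∕ UpperRowPure ∕ Minimal ∕ H2 ∕ nCharged`, the lemma
`upperRowPure_self`, the reduction `not_H1_and_H2_of_main` (via `exists_fullyCharged_of_H1`), and `H2` ONLY at the Weil
directions `κ = E_{gg'}` (lower columns: the ray rule S2a and the column reading S3; upper systems: the ray rule S2b and THE
END below). It is a sentence about these finite linear systems, not about `stub_rung_pad4_seedAt`, sheaves or cycles.
FRAMING OF RECORD (director-hodge g10, cell INBOX l.31483 (a)): everything in this file is a theorem of the finite-dimensional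
FIRST-ORDER MODEL of row 716 (`Pad4FirstOrderModel.lean`) and of nothing else; the model-to-sheaf bridge (Buchweitz–Flenner 2003)
is NOT in the tree; the cell's (S3) ∕ (S5) STATUS WORDS do not move; no object is certified; nothing here bears on HC ∕ HC_CM ∕
HC_AV ∕ W₆ or on `stub_rung_pad4_seedAt`.
Typed ≠ endorsed.
-/

noncomputable section
namespace Summit.Ventures.HSemireg.Pad4FirstOrder
open Finset

section End
variable {D : Design} {φ : D.Sections} (T : TopFlag D φ)

/-- `Σ_a c_a · Σ_b F(a, b) = Σ_b Σ_a c_a · F(a, b)`. -/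
theorem sum_mul_sum_comm {α β : Type*} (s : Finset α) (t : Finset β) (c : α → ℂ) (F : α → β → ℂ) :
    ∑ a ∈ s, c a * ∑ b ∈ t, F a b = ∑ b ∈ t, ∑ a ∈ s, c a * F a b := by
  rw [Finset.sum_congr rfl (fun a _ => Finset.mul_sum _ _ _), Finset.sum_comm]

/-- `Σ_a Σ_{o ∈ t(a)} c_{a,o} · Σ_b F(a, o, b) = Σ_b Σ_a Σ_o c_{a,o} · F(a, o, b)`. -/
theorem sum_sum_mul_sum_comm {α β γ : Type*} (s : Finset α) (t : α → Finset γ) (u : Finset β) (c : α → γ → ℂ)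
    (F : α → γ → β → ℂ) :
    ∑ a ∈ s, ∑ o ∈ t a, c a o * ∑ b ∈ u, F a o b = ∑ b ∈ u, ∑ a ∈ s, ∑ o ∈ t a, c a o * F a o b := by
  rw [Finset.sum_congr rfl (fun a _ => Finset.sum_congr rfl (fun o _ => Finset.mul_sum _ _ _)),
    Finset.sum_congr rfl (fun a _ => Finset.sum_comm), Finset.sum_comm]

/-- membership in the index set of the copies of `Q₀`. -/
theorem TopFlag.mem_q0Set (j : Fin D.nP) : j ∈ T.q0Set ↔ T.IsQ0 j := by
  unfold TopFlag.q0Set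
  simp only [Finset.mem_filter, Finset.mem_univ, true_and]

/-- membership in the index set of the companions below `s`. -/
theorem TopFlag.mem_compSet (s : ℕ) (j : Fin D.nP) : j ∈ T.compSet s ↔ T.IsComp j ∧ (D.P j).charge T.f < s := by
  unfold TopFlag.compSet
  simp only [Finset.mem_filter, Finset.mem_univ, true_and]

/-- THE END at an f-server `S = N r`: its bracket `Σ_{copies s} μ_s · term(s) + Σ_{companions C < S} Σ_{o'} g_C(o') · term(C, o')`
is `Σ_ι η'_S(ι, y) · (R1 at ι) = 0`. -/
theorem end_bracket_server (η' : Fin D.nN → (Fin 4 → ℕ) → (Fin 4 → ℕ × ℕ) → ℂ) {τ : Fin 4} (hτf : τ ≠ T.f)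
    {j₀ : Fin D.nP} (hj₀ : T.IsQ0 j₀) {r : Fin D.nN} (hr : T.IsServer r) (μ : Fin D.nP → ℂ)
    (g : Fin D.nP → (ℕ × ℕ) → ℂ)
    (hR1 : ∀ o ∈ monIdx ((D.N r).charge T.f - (D.N T.i).charge T.f),
      ∑ j ∈ T.q0Set, μ j * φ r j (Function.update (fun _ => ((0 : ℕ), (0 : ℕ))) T.f o) +
        ∑ j ∈ T.compSet ((D.N r).charge T.f), ∑ ι' ∈ monIdx ((D.P j).charge T.f - (D.N T.i).charge T.f),
          ∑ a' ∈ monIdx ((D.N r).charge T.f - (D.P j).charge T.f),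
            (mulCoef ι' a' o : ℂ) * g j ι' * φ r j (Function.update (fun _ => ((0 : ℕ), (0 : ℕ))) T.f a') = 0)
    (y : ℕ × ℕ) (hy : y = (0, 0) ∨ y = (1, 0)) :
    ∑ s ∈ T.q0Set, μ s *
        ∑ u ∈ idxH2 (D.P j₀) (D.N r), ∑ a ∈ idxH0 (D.N r) (D.P s),
          (if u.1 = qPair T.f τ then coefProd (rel (D.P j₀) (D.N r)) (rel (D.N r) (D.P s)) (qPair T.f τ) u.2 a
            (Function.update (fun _ => ((0 : ℕ), (0 : ℕ))) τ y) else 0) * φ r s a * η' r u.1 u.2 +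
      ∑ s ∈ T.compSet ((D.N r).charge T.f), ∑ o' ∈ monIdx ((D.P s).charge T.f - (D.N T.i).charge T.f), g s o' *
        ∑ u ∈ idxH2 (D.P j₀) (D.N r), ∑ a ∈ idxH0 (D.N r) (D.P s),
          (if u.1 = qPair T.f τ then coefProd (rel (D.P j₀) (D.N r)) (rel (D.N r) (D.P s)) (qPair T.f τ) u.2 a
            (Function.update (Function.update (fun _ => ((0 : ℕ), (0 : ℕ))) T.f o') τ y) else 0) * φ r s a *
            η' r u.1 u.2 = 0 := by
  rw [Finset.sum_congr rfl (fun s hs => by rw [upper_term_server_Q0 T η' hτf hj₀ hr ((T.mem_q0Set s).1 hs) y hy]),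
    Finset.sum_congr rfl (fun s hs => Finset.sum_congr rfl (fun o' _ => by
      rw [upper_term_server_comp T η' hτf hj₀ hr ((T.mem_compSet _ s).1 hs).1 ((T.mem_compSet _ s).1 hs).2 o' y hy]))]
  have h0 : ∑ ι ∈ monIdx ((D.N r).charge T.f - (D.N T.i).charge T.f),
      (∑ j ∈ T.q0Set, μ j * φ r j (Function.update (fun _ => ((0 : ℕ), (0 : ℕ))) T.f ι) +
        ∑ j ∈ T.compSet ((D.N r).charge T.f), ∑ ι' ∈ monIdx ((D.P j).charge T.f - (D.N T.i).charge T.f),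
          ∑ a' ∈ monIdx ((D.N r).charge T.f - (D.P j).charge T.f),
            (mulCoef ι' a' ι : ℂ) * g j ι' * φ r j (Function.update (fun _ => ((0 : ℕ), (0 : ℕ))) T.f a')) *
        η' r (qPair T.f τ) (Function.update (Function.update (fun _ => ((0 : ℕ), (0 : ℕ))) T.f ι) τ y) = 0 :=
    Finset.sum_eq_zero fun ι hι => by rw [hR1 ι hι, zero_mul]
  rw [← h0]
  simp only [add_mul, Finset.sum_mul, Finset.mul_sum, Finset.sum_add_distrib]
  congr 1
  · rw [Finset.sum_comm]
    exact Finset.sum_congr rfl fun ι _ => Finset.sum_congr rfl fun s _ => by ring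
  · rw [Finset.sum_comm]
    refine Finset.sum_congr rfl fun s _ => ?_
    rw [Finset.sum_comm]
    refine Finset.sum_congr rfl fun ι _ => Finset.sum_congr rfl fun o' _ => Finset.sum_congr rfl fun a' _ => ?_
    rw [mulCoef_comm a' o' ι]
    ring

/-- THE END at a τ-flag `X' = N r`: its bracket is `ξ̄_{ζ'}(y) Σ_ι η'_{X'}(ē_A, ι) · (R2 at ι) = 0` (companions do not reach `X'`). -/
theorem end_bracket_flag (η' : Fin D.nN → (Fin 4 → ℕ) → (Fin 4 → ℕ × ℕ) → ℂ) {τ : Fin 4} (hτf : τ ≠ T.f)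
    {j₀ : Fin D.nP} (hj₀ : T.IsQ0 j₀) {r : Fin D.nN} (hr : T.IsFlagOn τ r) (μ : Fin D.nP → ℂ)
    (g : Fin D.nP → (ℕ × ℕ) → ℂ) (C : Finset (Fin D.nP)) (hC : ∀ s ∈ C, T.IsComp s)
    (hR2 : ∀ o ∈ monIdx ((D.N r).charge τ),
      ∑ j ∈ T.q0Set, μ j * φ r j (Function.update (fun _ => ((0 : ℕ), (0 : ℕ))) τ o) = 0) (y : ℕ × ℕ) :
    ∑ s ∈ T.q0Set, μ s *
        ∑ u ∈ idxH2 (D.P j₀) (D.N r), ∑ a ∈ idxH0 (D.N r) (D.P s),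
          (if u.1 = qPair T.f τ then coefProd (rel (D.P j₀) (D.N r)) (rel (D.N r) (D.P s)) (qPair T.f τ) u.2 a
            (Function.update (fun _ => ((0 : ℕ), (0 : ℕ))) τ y) else 0) * φ r s a * η' r u.1 u.2 +
      ∑ s ∈ C, ∑ o' ∈ monIdx ((D.P s).charge T.f - (D.N T.i).charge T.f), g s o' *
        ∑ u ∈ idxH2 (D.P j₀) (D.N r), ∑ a ∈ idxH0 (D.N r) (D.P s),
          (if u.1 = qPair T.f τ then coefProd (rel (D.P j₀) (D.N r)) (rel (D.N r) (D.P s)) (qPair T.f τ) u.2 a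
            (Function.update (Function.update (fun _ => ((0 : ℕ), (0 : ℕ))) T.f o') τ y) else 0) * φ r s a *
            η' r u.1 u.2 = 0 := by
  rw [Finset.sum_congr rfl (fun s hs => by rw [upper_term_flag_Q0 T η' hτf hj₀ hr ((T.mem_q0Set s).1 hs) y]),
    Finset.sum_eq_zero (fun s hs => Finset.sum_eq_zero fun o' _ => by
      rw [upper_term_flag_comp_zero T η' hr (hC s hs), mul_zero]), add_zero]
  have h0 : ∑ ι ∈ monIdx ((D.N r).charge τ),
      (∑ j ∈ T.q0Set, μ j * φ r j (Function.update (fun _ => ((0 : ℕ), (0 : ℕ))) τ ι)) *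
        (xiBar ((D.N r).phase τ) y *
          η' r (qPair T.f τ) (Function.update (Function.update (fun _ => ((0 : ℕ), (0 : ℕ))) T.f (0, 0)) τ ι)) = 0 :=
    Finset.sum_eq_zero fun ι hι => by rw [hR2 ι hι, zero_mul]
  rw [← h0]
  simp only [Finset.sum_mul, Finset.mul_sum]
  rw [Finset.sum_comm]
  exact Finset.sum_congr rfl fun ι _ => Finset.sum_congr rfl fun s _ => by ring

/-- **THE END.** Given the server identities (R1) and the τ-flag identities (R2) for scalars `μ_j` (copies of `Q₀`) and
ring elements `g_C` (companions), the `E₊`-side system of a copy `Q₀^{j₀}` at `κ₁ = E_{τf}` forces `μ_{j₀} = 0`. -/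
theorem end_coeff_eq_zero (hmin : D.Minimal φ) {τ : Fin 4} (hτf : τ ≠ T.f) (μ : Fin D.nP → ℂ)
    (g : Fin D.nP → (ℕ × ℕ) → ℂ)
    (hR1 : ∀ r, T.IsServer r → ∀ o ∈ monIdx ((D.N r).charge T.f - (D.N T.i).charge T.f),
      ∑ j ∈ T.q0Set, μ j * φ r j (Function.update (fun _ => ((0 : ℕ), (0 : ℕ))) T.f o) +
        ∑ j ∈ T.compSet ((D.N r).charge T.f), ∑ ι' ∈ monIdx ((D.P j).charge T.f - (D.N T.i).charge T.f),
          ∑ a' ∈ monIdx ((D.N r).charge T.f - (D.P j).charge T.f),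
            (mulCoef ι' a' o : ℂ) * g j ι' * φ r j (Function.update (fun _ => ((0 : ℕ), (0 : ℕ))) T.f a') = 0)
    (hR2 : ∀ r, T.IsFlagOn τ r → ∀ o ∈ monIdx ((D.N r).charge τ),
      ∑ j ∈ T.q0Set, μ j * φ r j (Function.update (fun _ => ((0 : ℕ), (0 : ℕ))) τ o) = 0)
    {j₀ : Fin D.nP} (hj₀ : T.IsQ0 j₀)
    (hup : D.UpperRowSolvable φ (Matrix.of fun a b => if a = τ ∧ b = T.f then (1 : ℂ) else 0) j₀) :
    μ j₀ = 0 := by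
  classical
  obtain ⟨η', hη'⟩ := hup
  obtain ⟨hQl, hQf, hQph, hQ0⟩ := topFlag_Q0 D φ T j₀ hj₀
  -- the companions (all of them; those not below a given server drop out row by row)
  set C : Finset (Fin D.nP) := univ.filter fun s => T.IsComp s with hCdef
  have hC : ∀ s ∈ C, T.IsComp s := fun s hs => (mem_filter.1 hs).2
  -- (★) from the system: the combination at `[f ↦ ē_A, τ ↦ y]` equals `μ_{j₀} · ob_{κ₁}(Q₀)`
  have star : ∀ y : ℕ × ℕ, (y = (0, 0) ∨ y = (1, 0)) →
      ∑ s ∈ T.q0Set, μ s * D.upperLHS φ η' j₀ s (qPair T.f τ, Function.update (fun _ => ((0 : ℕ), (0 : ℕ))) τ y) +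
        ∑ s ∈ C, ∑ o' ∈ monIdx ((D.P s).charge T.f - (D.N T.i).charge T.f), g s o' *
          D.upperLHS φ η' j₀ s
            (qPair T.f τ, Function.update (Function.update (fun _ => ((0 : ℕ), (0 : ℕ))) T.f o') τ y) =
      μ j₀ * ob (D.P j₀) (Matrix.of fun a b => if a = τ ∧ b = T.f then (1 : ℂ) else 0) (qPair T.f τ)
        (Function.update (fun _ => ((0 : ℕ), (0 : ℕ))) τ y) := by
    intro y hy
    rw [Finset.sum_eq_zero (s := C) (fun s hs => Finset.sum_eq_zero fun o' ho' => by
      rw [hη' s (T.upperRowPure_of hj₀ (Or.inr (hC s hs))) _ (T.mem_idxH2_Q0_comp hτf hj₀ (hC s hs) ho' y hy),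
        if_neg (fun h => by have := (hC s hs).2.2.1; rw [h, hQf] at this; exact lt_irrefl _ this), mul_zero]), add_zero,
      Finset.sum_congr rfl (fun s hs => by
        rw [hη' s (T.upperRowPure_of hj₀ (Or.inl ((T.mem_q0Set s).1 hs))) _
          (T.mem_idxH2_Q0_Q0 hτf hj₀ ((T.mem_q0Set s).1 hs) y hy), mul_ite, mul_zero]),
      Finset.sum_ite_eq' T.q0Set j₀, if_pos ((T.mem_q0Set j₀).2 hj₀)]
  -- (★★) by expansion: the same combination vanishes, participant by participant
  have zero : ∀ y : ℕ × ℕ, (y = (0, 0) ∨ y = (1, 0)) →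
      ∑ s ∈ T.q0Set, μ s * D.upperLHS φ η' j₀ s (qPair T.f τ, Function.update (fun _ => ((0 : ℕ), (0 : ℕ))) τ y) +
        ∑ s ∈ C, ∑ o' ∈ monIdx ((D.P s).charge T.f - (D.N T.i).charge T.f), g s o' *
          D.upperLHS φ η' j₀ s
            (qPair T.f τ, Function.update (Function.update (fun _ => ((0 : ℕ), (0 : ℕ))) T.f o') τ y) = 0 := by
    intro y hy
    simp only [Design.upperLHS]
    rw [sum_mul_sum_comm T.q0Set univ μ, sum_sum_mul_sum_comm C _ univ g, ← Finset.sum_add_distrib]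
    refine Finset.sum_eq_zero fun r _ => ?_
    by_cases hrS : T.IsServer r
    · -- an f-server: restrict the companions to those below it, then (R1)
      rw [← Finset.sum_subset (s₁ := T.compSet ((D.N r).charge T.f)) (s₂ := C)
        (fun s hs => mem_filter.2 ⟨mem_univ _, ((T.mem_compSet _ s).1 hs).1⟩)
        (fun s hs hns => Finset.sum_eq_zero fun o' _ => by
          rw [upper_term_server_comp_zero T hmin η' hrS (hC s hs)
            (fun hlt => hns ((T.mem_compSet _ s).2 ⟨hC s hs, hlt⟩)), mul_zero])]
      exact end_bracket_server T η' hτf hj₀ hrS μ g (hR1 r hrS) y hy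
    by_cases hrF : T.IsFlagOn τ r
    · exact end_bracket_flag T η' hτf hj₀ hrF μ g C hC (hR2 r hrF) y
    · -- nothing else participates
      rw [Finset.sum_eq_zero (fun s hs => by
          rw [upper_term_other_zero T hmin η' hτf hj₀ hrS hrF (Or.inl ((T.mem_q0Set s).1 hs)), mul_zero]),
        Finset.sum_eq_zero (fun s hs => Finset.sum_eq_zero fun o' _ => by
          rw [upper_term_other_zero T hmin η' hτf hj₀ hrS hrF (Or.inr (hC s hs)), mul_zero]), add_zero]
  -- so `μ_{j₀} · ob_{κ₁}(Q₀)(ē_A, y) = 0` for `y = ē_A, ē_B`, while `ob(ē_A, ē_B) − ζ̄_τ ob(ē_A, ē_A) = ± h ≠ 0`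
  have hB := (star (1, 0) (Or.inr rfl)).symm.trans (zero (1, 0) (Or.inr rfl))
  have hA := (star (0, 0) (Or.inl rfl)).symm.trans (zero (0, 0) (Or.inl rfl))
  have hw := ob_qPair_wImage_E_A (D.P j₀) T.f τ hτf.symm (fun _ => ((0 : ℕ), (0 : ℕ))) rfl
  have key : μ j₀ * ((if T.f < τ then 1 else -1) * ((D.P j₀).charge T.f : ℂ)) = 0 := by
    rw [← hw, mul_sub, hB, mul_left_comm, hA]; ring
  have hne : (if T.f < τ then (1 : ℂ) else -1) * ((D.P j₀).charge T.f : ℂ) ≠ 0 :=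
    mul_ne_zero (by split_ifs <;> norm_num) (Nat.cast_ne_zero.mpr (by rw [hQf]; exact T.flag_f))
  exact (mul_eq_zero.1 key).resolve_right hne

end End

/-! ## THEOREM L^ζ in the first-order model -/

/-- **THEOREM L^ζ, main form, PROVED IN THE FIRST-ORDER MODEL**: a two-level design of the standard-null-letter class with
minimal presentation and some constituent charged on at least two factors violates (E1) = `H2`, for every choice of
sections (PAD4-THEOREM-L v1.2 §5 CLAIM; kernel proof: top flag S2c → column reading S3 at `E_{fσ}` → THE END at `E_{τf}`). -/
theorem theoremLZetaMain_holds : TheoremLZetaMain := by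
  intro D φ _ hmin hX h2
  obtain ⟨T⟩ := exists_topFlag D φ hmin h2 hX
  -- a third axis `τ ∉ {σ, f}`
  obtain ⟨τ, hτσ, hτf⟩ : ∃ τ : Fin 4, τ ≠ T.σ ∧ τ ≠ T.f := by
    have hcard : 0 < ((univ.erase T.σ).erase T.f).card := by
      rw [Finset.card_erase_of_mem (mem_erase.mpr ⟨T.hσf.symm, mem_univ _⟩), Finset.card_erase_of_mem (mem_univ _),
        Finset.card_univ, Fintype.card_fin]
      decide
    obtain ⟨τ, hτ⟩ := Finset.card_pos.mp hcard
    exact ⟨τ, ne_of_mem_erase (mem_of_mem_erase hτ), ne_of_mem_erase hτ⟩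
  -- the column of the flag at `κ₀ = E_{fσ}`
  obtain ⟨v, hD, hR1, hR2⟩ := column_reading T hmin ((h2 _).1 T.i)
  -- THE END at `κ₁ = E_{τf}`: every `u_{j₀}(x)` vanishes
  have hu : ∀ j₀ ∈ T.q0Set, ∀ x ∈ monIdx ((D.N T.i).charge T.σ),
      v j₀ x (1, 0) - zetaBar ((D.N T.i).phase T.f) * v j₀ x (0, 0) = 0 := fun j₀ hj₀ x hx =>
    end_coeff_eq_zero T hmin hτf (fun j => v j x (1, 0) - zetaBar ((D.N T.i).phase T.f) * v j x (0, 0))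
      (fun j ι' => v j x ι') (fun r hr o ho => hR1 r hr x hx o ho) (fun r hr o ho => hR2 τ hτσ hτf r hr x hx o ho)
      ((T.mem_q0Set j₀).1 hj₀) ((h2 _).2 j₀)
  -- so the diagonal row's `w_ζ`-image `± a` is `0`: impossible, `a ≥ 1`
  have h0 : (if T.σ < T.f then (1 : ℂ) else -1) * ((D.N T.i).charge T.σ : ℂ) = 0 := by
    rw [← hD]
    exact Finset.sum_eq_zero fun j hj => Finset.sum_eq_zero fun x hx => by rw [hu j hj x hx, zero_mul]
  exact mul_ne_zero (by split_ifs <;> norm_num) (Nat.cast_ne_zero.mpr T.flag_σ) h0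

/-- **THEOREM L^ζ PROVED IN THE FIRST-ORDER MODEL**: no class-y design with minimal presentation satisfies (H1) ∧ (H2)
(the corollary form, via row 716's `not_H1_and_H2_of_main`: (H1) forces a fully charged constituent). -/
theorem theoremLZeta_holds : TheoremLZeta := fun D φ hY hmin =>
  not_H1_and_H2_of_main theoremLZetaMain_holds D φ hY hmin

end Summit.Ventures.HSemireg.Pad4FirstOrder
end
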